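import Mathlib
import Summits.NavierStokesRegularity.NavierStokesRegularity.Theorems.SubOnsagerCeilingSmallRatioSuffices
import Summits.NavierStokesRegularity.NavierStokesRegularity.Theorems.SubOnsagerCeilingKPStubOneCorners
import Summits.NavierStokesRegularity.NavierStokesRegularity.Theorems.SubOnsagerCeilingKPStubOneSideBranch
import HarnessLib

/-!
# NO THEOREM-4.2 BLOW-UP for the proved KP architecture classes at every shell ratio `b ∈ [5/4, 2]`
# — the body of the rung target `TaoLadderRungTwoBreak.Target` on these tables, BY NAME (modulo the CLOSED item `OrthantInvariance`)
(helper file for the crux `SubOnsagerCeiling.ForwardTailCeilingKP`, stmt-NavierStokesRegularity-27057, `--supports`;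
hand leafhand-ns-subonsagerceiling-4 gen 22)

The rung-`TL-M2Break` leaf is `¬NoGlobalCascade ε₀ α X₀` (no Theorem-4.2-level blow-up: for some implied constants, global pseudo-solutions
from the one-shell datum `X₀` exist at all deep initial shells) for all tables of `E₂(R)` at small ratios.  For the architecture classes on
which the hands have landed the ν-uniform ceiling, the leaf's body follows table by table and ratio by ratio from
`kp_not_noGlobalCascade_of_fwdCeilingKPAt` (`SubOnsagerCeilingSmallRatioSuffices`: ceiling ⇒ subcritical envelope ⇒ `ForwardSourceSmoothing`
(closed, discharged by `ForwardSourceSmoothing_holds`) ⇒ global viscous solution ⇒ global pseudo-solution); the closed item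
`OrthantInvariance` (stmt-25508, proved as `subOnsagerCeiling_orthantInvariance_proof`, whose module sits in another route's import cone) is
kept as an explicit hypothesis `hI`:

* `kp_not_noGlobalCascade_of_ceilingAt` — per table, per ratio: `CeilingAt R ε₀ α` (all four components, any `θ > 1/2`) for an orthant
  table `α ∈ E₂(R)` gives `¬NoGlobalCascade ε₀ α X₀` for every datum (`S = univ`; no diagonal-feed hypothesis needed);
* **`classOne_not_noGlobalCascade`** — for every table of the class `𝒞₁` = {scaled Katz–Pavlović chain, uniform KP permutation network,
  uniform KP fan network, uniform re-entry pair} at ANY placement `σ`, every spread `R` with `β ∈ E₂(R)` orthant, EVERY `ε₀ ∈ [1/4, 1]` and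
  every one-shell datum: `¬NoGlobalCascade ε₀ β X₀` (modulo the closed `OrthantInvariance`);
* `sideBranchClass_not_noGlobalCascade` (`b ∈ [1.9, 2]`), `sideBranchClassTen_not_noGlobalCascade` (`b ∈ [1.78, 2]`) — the same for the
  side-branch classes of RUNGS 5 / 9 (chain + in-shell pump + exit feed into a dead-end pocket), at any placement.

HONEST FRAMING: statements about Tao-type MODEL lattice ODEs (route SubOnsagerCeiling, rung TL-M2Break): absence of Theorem-4.2 blow-up
for specific positive KP networks at shell ratios `≥ 5/4` — NOT at the small ratios the rung target quantifies over, and nothing about the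
Navier–Stokes equations; no stub, crux, rung target or summit is proved. [cite: Tao2016AveragedNS, §4 Thm. 4.2, (4.13)]
[cite: BarbatoMorandinRomito2011, §3.2]
-/

noncomputable section

-- the sub-problem namespace `NavierStokesRegularity.NavierStokesRegularity` is the tree's layout (D-0017)
set_option linter.dupNamespace false

namespace Summit.NavierStokesRegularity.NavierStokesRegularity.Theorems

open Set Filter
open scoped Topology
open Literature.Analysis.FluidPDE.TaoCascade
open Summit.NavierStokesRegularity.NavierStokesRegularity.Theses.SubOnsagerCeiling
open Summit.NavierStokesRegularity.NavierStokesRegularity.Theorems.SubOnsagerCeiling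

/-- **Per table, per ratio: a total-energy tail ceiling forbids Theorem-4.2 blow-up.**  `CeilingAt R ε₀ α` for an orthant table
`α ∈ E₂(R)` gives `¬NoGlobalCascade ε₀ α X₀` for every one-shell datum (`S = univ`; no diagonal-feed input; `OrthantInvariance`
as hypothesis, `ForwardSourceSmoothing` discharged). MODEL lattice statement. [cite: Tao2016AveragedNS, §4 Thm. 4.2] -/
theorem kp_not_noGlobalCascade_of_ceilingAt {R ε₀ : ℝ} (hε₀ : 0 < ε₀)
    {α : Fin 4 → Fin 4 → Fin 4 → ℤ × ℤ × ℤ → ℝ} (hC : CeilingAt R ε₀ α)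
    (hα : Literature.Analysis.FluidPDE.TaoCascade.InTableClass R α)
    (hK : ∀ (Y : Fin 4 → ℤ → ℝ → ℝ) (τ : ℝ), (∀ (j : Fin 4) (k : ℤ), 1 ≤ k → 0 ≤ Y j k τ) → ∀ δ : ℝ, 0 < δ →
      ∀ (i : Fin 4) (n : ℤ), 1 ≤ n → Y i n τ = 0 → 0 ≤ Literature.Analysis.FluidPDE.TaoCascade.quadTerm δ α Y i n τ)
    (hI : OrthantInvariance) (X₀ : Fin 4 → ℝ) :
    ¬ Literature.Analysis.FluidPDE.TaoCascade.NoGlobalCascade ε₀ α X₀ := by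
  have hB : ForwardSourceSmoothing := ForwardSourceSmoothing_holds
  unfold Summit.NavierStokesRegularity.NavierStokesRegularity.Theses.SubOnsagerCeiling.OrthantInvariance at hI
  unfold Summit.NavierStokesRegularity.NavierStokesRegularity.Theses.SubOnsagerCeiling.ForwardSourceSmoothing at hB
  intro hNG
  obtain ⟨κ, hκ, hno⟩ := (noGlobalCascade_iff_kappa hε₀).1 hNG
  have h2 : 0 < Real.sqrt 2 := Real.sqrt_pos.2 two_pos
  have hν : 0 < κ / Real.sqrt 2 := div_pos hκ h2
  obtain ⟨θ, hθ, C, _hC0, H⟩ := hC hα hK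
  have hη : 0 < 2 * θ - 1 := by linarith
  obtain ⟨X, hX⟩ := hB ε₀ (2 * θ - 1) R hε₀ hη α hα Finset.univ
    (fun i hi => absurd (Finset.mem_univ i) hi) X₀ (κ / Real.sqrt 2) hν
    (fun T _hT => ⟨C * (∑ i : Fin 4, (1 / 2 : ℝ) * X₀ i ^ 2),
      fun s hs Y hinit hlow hbd hcont hder n N hnN t ht => by
        have hnonneg := hI ε₀ (κ / Real.sqrt 2) hε₀ hν α hK X₀ s hs.1 Y hinit hlow hbd hcont hder
        have hceil := H (κ / Real.sqrt 2) hν X₀ s hs.1 Y hinit hlow hbd hcont hder hnonneg n N hnN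
          t ht
        have hexp : -((1 + (2 * θ - 1)) * (n : ℝ)) = -(2 * θ * (n : ℝ)) := by ring
        rw [hexp]
        simpa using hceil⟩)
  have hG := hasGlobal_of_viscousGlobal hε₀ hν.le hX
  rw [div_mul_cancel₀ κ h2.ne'] at hG
  exact hno (hasGlobal_mono hε₀.le hG le_rfl hκ.le)

/-- **NO THEOREM-4.2 BLOW-UP ON THE CLASS `𝒞₁` AT EVERY `b ∈ [5/4, 2]`.**  For a table `β` which is, at some placement `σ` of the
components, a scaled Katz–Pavlović chain, a uniform KP permutation network, a uniform KP fan network or the uniform re-entry pair;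
for every spread `R` with `β ∈ E₂(R)`, `β` orthant; every `ε₀ ∈ [1/4, 1]` and every one-shell datum `X₀`:
`¬NoGlobalCascade ε₀ β X₀` — modulo the closed item `OrthantInvariance` (`classOne_ceilingAt_quarter` — the chain descent RUNGS 1–29 and
the strand transfers — through `kp_not_noGlobalCascade_of_ceilingAt`). MODEL lattice statement. [cite: Tao2016AveragedNS, §4 Thm. 4.2]
[cite: BarbatoMorandinRomito2011, §3.2] -/
theorem classOne_not_noGlobalCascade {β : Fin 4 → Fin 4 → Fin 4 → ℤ × ℤ × ℤ → ℝ} (σ : Equiv.Perm (Fin 4))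
    (hβ : (∃ c : ℝ, 0 < c ∧ ∀ i₁ i₂ i₃ μ, β i₁ i₂ i₃ μ = c * dyadicTable (σ i₁) (σ i₂) (σ i₃) μ) ∨
      (∃ (τ : Equiv.Perm (Fin 4)) (c : Fin 4 → ℝ), (∀ a, c (τ a) = c a) ∧
        ∀ i₁ i₂ i₃ μ, β i₁ i₂ i₃ μ = kpPermTable τ c (σ i₁) (σ i₂) (σ i₃) μ) ∨
      (∃ w : Fin 4 → ℝ, ∀ i₁ i₂ i₃ μ, β i₁ i₂ i₃ μ = kpFanTable w (σ i₁) (σ i₂) (σ i₃) μ) ∨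
      (∃ c : ℝ, 0 < c ∧ ∀ i₁ i₂ i₃ μ, β i₁ i₂ i₃ μ = kpTwoCycleTable c c (σ i₁) (σ i₂) (σ i₃) μ))
    {R ε₀ : ℝ} (hε : (1 : ℝ) / 4 ≤ ε₀) (hε1 : ε₀ ≤ 1)
    (hT : Literature.Analysis.FluidPDE.TaoCascade.InTableClass R β)
    (hK : ∀ (Y : Fin 4 → ℤ → ℝ → ℝ) (τ : ℝ), (∀ (j : Fin 4) (k : ℤ), 1 ≤ k → 0 ≤ Y j k τ) → ∀ δ : ℝ, 0 < δ →
      ∀ (i : Fin 4) (n : ℤ), 1 ≤ n → Y i n τ = 0 → 0 ≤ Literature.Analysis.FluidPDE.TaoCascade.quadTerm δ β Y i n τ)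
    (hI : OrthantInvariance) (X₀ : Fin 4 → ℝ) :
    ¬ Literature.Analysis.FluidPDE.TaoCascade.NoGlobalCascade ε₀ β X₀ :=
  kp_not_noGlobalCascade_of_ceilingAt (by linarith) (classOne_ceilingAt_quarter σ hβ R ε₀ hε hε1) hT hK hI X₀

/-- **No Theorem-4.2 blow-up on the side-branch class (RUNG 5), `b ∈ [1.9, 2]`, any placement.**  For a table `β ∈ E₂(R)`, orthant with
diagonal forward feeds, in the side-branch class placed by `σ` (hypotheses of `kpRelabel_sideClass_fwdCeilingKP`), every
`ε₀ ∈ [9/10, 1]` and every datum: `¬NoGlobalCascade ε₀ β X₀` (modulo the closed `OrthantInvariance`). MODEL lattice statement. [cite: Tao2016AveragedNS, §4 Thm. 4.2] -/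
theorem sideBranchClass_not_noGlobalCascade {β : Fin 4 → Fin 4 → Fin 4 → ℤ × ℤ × ℤ → ℝ} (σ : Equiv.Perm (Fin 4))
    (R : ℝ) {ε₀ c₀ P f κ : ℝ} (hε : 9 / 10 ≤ ε₀) (hε1 : ε₀ ≤ 1)
    (hw : ∀ a c : Fin 4, β a a c (0, 0, 1) =
      (if σ a = 0 ∧ σ c = 0 then c₀ else 0) + (if σ a = 1 ∧ σ c = 2 then f else 0))
    (hP : ∀ a c : Fin 4, a ≠ c → β a a c (0, 0, 0) = if σ a = 0 ∧ σ c = 1 then P else 0)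
    (hCz : ∀ a b c : Fin 4, a ≠ b → a ≠ c → b ≠ c → β a b c (0, 0, 0) = 0)
    (hc₀ : 0 < c₀) (hP0 : 0 ≤ P) (hf : 0 < f) (hκ : 0 < κ)
    (hpair : 13 * P ^ 2 < f ^ 2 * κ ^ 4)
    (hdrain : 5 * P * κ * (1 + ε₀) ^ ((5 : ℝ) / 2) ≤ c₀ * ((1 + ε₀) ^ ((101 : ℝ) / 200)) ^ 2)
    (hP1 : P * (1 + ε₀) ^ ((5 : ℝ) / 2) ≤ 2 * c₀ * ((1 + ε₀) ^ ((101 : ℝ) / 200)) ^ 2)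
    (hT : Literature.Analysis.FluidPDE.TaoCascade.InTableClass R β)
    (hK : ∀ (Y : Fin 4 → ℤ → ℝ → ℝ) (τ : ℝ), (∀ (j : Fin 4) (k : ℤ), 1 ≤ k → 0 ≤ Y j k τ) → ∀ δ : ℝ, 0 < δ →
      ∀ (i : Fin 4) (n : ℤ), 1 ≤ n → Y i n τ = 0 → 0 ≤ Literature.Analysis.FluidPDE.TaoCascade.quadTerm δ β Y i n τ)
    (hD : ∀ a b i : Fin 4, a ≠ b → β a b i (0, 0, 1) = 0) (hI : OrthantInvariance) (X₀ : Fin 4 → ℝ) :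
    ¬ Literature.Analysis.FluidPDE.TaoCascade.NoGlobalCascade ε₀ β X₀ :=
  kp_not_noGlobalCascade_of_fwdCeilingKPAt (by linarith)
    (kpRelabel_sideClass_fwdCeilingKP σ R hε hε1 hw hP hCz hc₀ hP0 hf hκ hpair hdrain hP1) hT hK hD hI X₀

/-- **No Theorem-4.2 blow-up on the halved-pump side-branch class (RUNG 9), `b ∈ [1.78, 2]`, any placement.**  Same for the class
of `kpRelabel_sideClassTen_fwdCeilingKP` at every `ε₀ ∈ [39/50, 1]` (modulo the closed `OrthantInvariance`). MODEL lattice statement. [cite: Tao2016AveragedNS, §4 Thm. 4.2] -/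
theorem sideBranchClassTen_not_noGlobalCascade {β : Fin 4 → Fin 4 → Fin 4 → ℤ × ℤ × ℤ → ℝ} (σ : Equiv.Perm (Fin 4))
    (R : ℝ) {ε₀ c₀ P f κ : ℝ} (hε : 39 / 50 ≤ ε₀) (hε1 : ε₀ ≤ 1)
    (hw : ∀ a c : Fin 4, β a a c (0, 0, 1) =
      (if σ a = 0 ∧ σ c = 0 then c₀ else 0) + (if σ a = 1 ∧ σ c = 2 then f else 0))
    (hP : ∀ a c : Fin 4, a ≠ c → β a a c (0, 0, 0) = if σ a = 0 ∧ σ c = 1 then P else 0)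
    (hCz : ∀ a b c : Fin 4, a ≠ b → a ≠ c → b ≠ c → β a b c (0, 0, 0) = 0)
    (hc₀ : 0 < c₀) (hP0 : 0 ≤ P) (hf : 0 < f) (hκ : 0 < κ)
    (hpair : 13 * P ^ 2 < f ^ 2 * κ ^ 4)
    (hdrain : 10 * P * κ * (1 + ε₀) ^ ((5 : ℝ) / 2) ≤ c₀ * ((1 + ε₀) ^ ((101 : ℝ) / 200)) ^ 2)
    (hP1 : P * (1 + ε₀) ^ ((5 : ℝ) / 2) ≤ c₀ * ((1 + ε₀) ^ ((101 : ℝ) / 200)) ^ 2)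
    (hT : Literature.Analysis.FluidPDE.TaoCascade.InTableClass R β)
    (hK : ∀ (Y : Fin 4 → ℤ → ℝ → ℝ) (τ : ℝ), (∀ (j : Fin 4) (k : ℤ), 1 ≤ k → 0 ≤ Y j k τ) → ∀ δ : ℝ, 0 < δ →
      ∀ (i : Fin 4) (n : ℤ), 1 ≤ n → Y i n τ = 0 → 0 ≤ Literature.Analysis.FluidPDE.TaoCascade.quadTerm δ β Y i n τ)
    (hD : ∀ a b i : Fin 4, a ≠ b → β a b i (0, 0, 1) = 0) (hI : OrthantInvariance) (X₀ : Fin 4 → ℝ) :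
    ¬ Literature.Analysis.FluidPDE.TaoCascade.NoGlobalCascade ε₀ β X₀ :=
  kp_not_noGlobalCascade_of_fwdCeilingKPAt (by linarith)
    (kpRelabel_sideClassTen_fwdCeilingKP σ R hε hε1 hw hP hCz hc₀ hP0 hf hκ hpair hdrain hP1) hT hK hD hI X₀

end Summit.NavierStokesRegularity.NavierStokesRegularity.Theorems

end
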